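import Literature.AlgebraicTopology.SingularHomology.MayerVietorisFiniteness
import HarnessLib

/-!
# Homology of the complement of a closed subset of large local codimension: the local-to-global Mayer–Vietoris induction

A. Hatcher, *Algebraic Topology* (2002), §3.3, proof of Thm. 3.35 / Lemma 3.36 (the method: a
statement about open subsets of a manifold which holds for small open sets, passes to unions of
two open sets by Mayer–Vietoris and to nested unions by compact supports, holds for all open
sets); C. Voisin, *Hodge Theory and Complex Algebraic Geometry I* (2002), §11.1.2, Lemma 11.13
(the statement it serves: for a closed complex submanifold `Y ⊂ X` of codimension `k`,
`Hˡ(X) → Hˡ(X − Y)` is an isomorphism for `l ≤ 2k − 2`, via `Hʲ(X, X − Y) = 0` for `j < 2k`).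

This file proves the TOPOLOGICAL ENGINE of such "semipurity" statements, for singular homology
with arbitrary coefficients, on an arbitrary second-countable space `X` with a closed subset `S`:

* `surjective_injective_map_diff_of_isTopologicalBasis` — **if `X` has a basis of open sets `B`
  for which `Hq(B ∖ S) → Hq(B)` is onto for `q < k` and one-to-one for `q + 1 < k`, then the same
  holds for EVERY open `U ⊆ X` in place of `B`** (equivalently `Hq(U, U ∖ S) = 0` for `q < k`);
  `surjective_map_compl_of_isTopologicalBasis` / `injective_map_compl_of_isTopologicalBasis` — the
  case `U = X`: `Hq(X ∖ S) → Hq(X)` is onto for `q < k` and one-to-one for `q + 1 < k`.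

The proof is an induction on the degree `q` (not on the open set): granted the statement in all
degrees `< q` for ALL open sets, the union of two open sets satisfying it in degree `q` again
does (`surjective_injective_map_diff_union`: two four-lemma chases on the ladder between the
Mayer–Vietoris sequences of `{U₁ ∖ S, U₂ ∖ S}` and `{U₁, U₂}` — the tree's `mayerVietoris.exact₁/₂/₃_holds`,
`δ_naturality_holds`, `ψ_surjective_zero` — where the intersection `U₁ ∩ U₂`, an arbitrary open
set, enters only in degrees `< q`); finite unions of basic open sets follow, and an arbitrary
open set is an increasing countable union of those, along which ontoness and one-to-one-ness pass
to the limit because singular homology has compact supports (`singularHomology.exists_eq_map_of_iUnion`,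
`exists_map_eq_zero_of_iUnion`, Hatcher Prop. 3.33). The point of inducting on the degree: in
the Mayer–Vietoris sequence `Hq(A ∩ B) → Hq(A) ⊕ Hq(B) → Hq(A ∪ B) → Hq₋₁(A ∩ B)` the
intersection is needed one degree LOWER, so no tubular neighbourhoods, Thom isomorphism or
dimension theory are required. Consumers supply the local input (e.g. straightened charts of a
submanifold of real codimension `≥ k`, where `B ∖ S ≃ ℝⁿ ∖ ℝⁿ⁻ᵏ ≃ Sᵏ⁻¹`).

Everything is proved; no definitions, no named facts.

## References

* [HatcherAT2002] A. Hatcher, Algebraic Topology, CUP 2002, §2.2 pp. 149–150 (Mayer–Vietoris),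
  §3.3 Prop. 3.33 (compact supports), proof of Thm. 3.35 and Lemma 3.36 (the induction over open
  sets).
* [VoisinHodgeI2002] C. Voisin, Hodge Theory and Complex Algebraic Geometry I, CUP 2002, §11.1.2
  Lemma 11.13.
-/

noncomputable section

open CategoryTheory Limits Set TopologicalSpace

universe u v w

namespace Literature.AlgebraicTopology.SingularHomology

/-! ### Two four-lemma chases on a ladder of modules -/

section Ladder

variable {R : Type v} [CommRing R]
variable {P' T' Q' N' P T Q N : ModuleCat.{w} R}

/-- **Four lemma, onto version, as a chase.** In the commutative ladder
`P' → T' → Q' → N'` over `P → T → Q → N` (vertical maps `a, b, c, d`): if the bottom row is a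
complex at `Q` and exact at `T`, the top row is exact at `Q'`, `a` and `c` are onto and `d` is
one-to-one, then `b` is onto. [folklore] -/
theorem surjective_of_ladder (ψ' : P' ⟶ T') (δ' : T' ⟶ Q') (φ' : Q' ⟶ N') (ψ : P ⟶ T)
    (δ : T ⟶ Q) (φ : Q ⟶ N) (a : P' ⟶ P) (b : T' ⟶ T) (c : Q' ⟶ Q) (d : N' ⟶ N)
    (sq₁ : ∀ x, b (ψ' x) = ψ (a x)) (sq₂ : ∀ x, c (δ' x) = δ (b x))
    (sq₃ : ∀ x, d (φ' x) = φ (c x)) (hδφ : ∀ x, φ (δ x) = 0)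
    (ex : ∀ t, δ t = 0 → ∃ p, ψ p = t) (ex' : ∀ y, φ' y = 0 → ∃ t, δ' t = y)
    (ha : Function.Surjective a) (hc : Function.Surjective c) (hd : Function.Injective d) :
    Function.Surjective b := by
  intro x
  obtain ⟨y', hy'⟩ := hc (δ x)
  have hφ' : φ' y' = 0 := hd (by rw [sq₃, hy', hδφ, map_zero])
  obtain ⟨x', hx'⟩ := ex' y' hφ'
  have hδ : δ (x - b x') = 0 := by rw [map_sub, ← sq₂, hx', hy', sub_self]
  obtain ⟨z, hz⟩ := ex _ hδ
  obtain ⟨z', rfl⟩ := ha z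
  refine ⟨x' + ψ' z', ?_⟩
  rw [map_add, sq₁, hz, add_sub_cancel]

/-- Degree-zero form of `surjective_of_ladder`: if `ψ : P → T` is onto, `a : P' → P` is onto and
`b ∘ ψ' = ψ ∘ a`, then `b` is onto. [folklore] -/
theorem surjective_of_ladder_zero (ψ' : P' ⟶ T') (ψ : P ⟶ T) (a : P' ⟶ P) (b : T' ⟶ T)
    (sq₁ : ∀ x, b (ψ' x) = ψ (a x)) (hψ : Function.Surjective ψ) (ha : Function.Surjective a) :
    Function.Surjective b := by
  intro x
  obtain ⟨z, rfl⟩ := hψ x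
  obtain ⟨z', rfl⟩ := ha z
  exact ⟨ψ' z', sq₁ z'⟩

/-- **Four lemma, one-to-one version, as a chase.** In the commutative ladder
`Q' → P' → T' → N'` over `Q → P → T → N` (vertical maps `c, a, b, d`; the last horizontal maps
are the connecting maps to the next intersection term): if the top row is a complex at `P'` and
exact at `T'`, the bottom row is exact at `P`, `c` is onto, `a` and `d` are one-to-one, then `b`
is one-to-one. [folklore] -/
theorem injective_of_ladder (φ' : Q' ⟶ P') (ψ' : P' ⟶ T') (δ' : T' ⟶ N') (φ : Q ⟶ P)
    (ψ : P ⟶ T) (δ : T ⟶ N) (c : Q' ⟶ Q) (a : P' ⟶ P) (b : T' ⟶ T) (d : N' ⟶ N)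
    (sq₀ : ∀ x, a (φ' x) = φ (c x)) (sq₁ : ∀ x, b (ψ' x) = ψ (a x))
    (sq₂ : ∀ x, d (δ' x) = δ (b x)) (hφψ' : ∀ x, ψ' (φ' x) = 0)
    (ex' : ∀ t, δ' t = 0 → ∃ p, ψ' p = t) (ex : ∀ p, ψ p = 0 → ∃ y, φ y = p)
    (hc : Function.Surjective c) (ha : Function.Injective a) (hd : Function.Injective d) :
    Function.Injective b := by
  refine (injective_iff_map_eq_zero _).2 fun z' hz' ↦ ?_
  have hδ' : δ' z' = 0 := hd (by rw [sq₂, hz', map_zero, map_zero])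
  obtain ⟨w', rfl⟩ := ex' z' hδ'
  have hψ : ψ (a w') = 0 := by rw [← sq₁, hz']
  obtain ⟨v, hv⟩ := ex _ hψ
  obtain ⟨v', rfl⟩ := hc v
  have hw' : w' = φ' v' := ha (by rw [sq₀, hv])
  rw [hw', hφψ']

/-- Degree-zero form of `injective_of_ladder` (no connecting map out of `T'`): if `ψ'` is onto,
the top row is a complex at `P'`, the bottom row is exact at `P`, `c` is onto and `a` is
one-to-one, then `b` is one-to-one. [folklore] -/
theorem injective_of_ladder_zero (φ' : Q' ⟶ P') (ψ' : P' ⟶ T') (φ : Q ⟶ P) (ψ : P ⟶ T)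
    (c : Q' ⟶ Q) (a : P' ⟶ P) (b : T' ⟶ T) (sq₀ : ∀ x, a (φ' x) = φ (c x))
    (sq₁ : ∀ x, b (ψ' x) = ψ (a x)) (hφψ' : ∀ x, ψ' (φ' x) = 0)
    (hψ' : Function.Surjective ψ') (ex : ∀ p, ψ p = 0 → ∃ y, φ y = p)
    (hc : Function.Surjective c) (ha : Function.Injective a) :
    Function.Injective b := by
  refine (injective_iff_map_eq_zero _).2 fun z' hz' ↦ ?_
  obtain ⟨w', rfl⟩ := hψ' z'
  have hψ : ψ (a w') = 0 := by rw [← sq₁, hz']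
  obtain ⟨v, hv⟩ := ex _ hψ
  obtain ⟨v', rfl⟩ := hc v
  have hw' : w' = φ' v' := ha (by rw [sq₀, hv])
  rw [hw', hφψ']

/-- A biproduct of two onto maps of modules is onto. [folklore] -/
theorem surjective_biprod_map {P₁ P₂ Q₁ Q₂ : ModuleCat.{w} R} (f : P₁ ⟶ Q₁) (g : P₂ ⟶ Q₂)
    (hf : Function.Surjective f) (hg : Function.Surjective g) :
    Function.Surjective (biprod.map f g) := by
  intro y
  obtain ⟨x₁, h₁⟩ := hf ((biprod.fst : Q₁ ⊞ Q₂ ⟶ Q₁) y)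
  obtain ⟨x₂, h₂⟩ := hg ((biprod.snd : Q₁ ⊞ Q₂ ⟶ Q₂) y)
  refine ⟨(biprod.inl : P₁ ⟶ P₁ ⊞ P₂) x₁ + (biprod.inr : P₂ ⟶ P₁ ⊞ P₂) x₂, ?_⟩
  have e₁ : (biprod.map f g) ((biprod.inl : P₁ ⟶ P₁ ⊞ P₂) x₁) =
      (biprod.inl : Q₁ ⟶ Q₁ ⊞ Q₂) ((biprod.fst : Q₁ ⊞ Q₂ ⟶ Q₁) y) := by
    rw [← ModuleCat.comp_apply, biprod.inl_map, ModuleCat.comp_apply, h₁]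
  have e₂ : (biprod.map f g) ((biprod.inr : P₂ ⟶ P₁ ⊞ P₂) x₂) =
      (biprod.inr : Q₂ ⟶ Q₁ ⊞ Q₂) ((biprod.snd : Q₁ ⊞ Q₂ ⟶ Q₂) y) := by
    rw [← ModuleCat.comp_apply, biprod.inr_map, ModuleCat.comp_apply, h₂]
  rw [map_add, e₁, e₂, biprod_apply_decomp]

/-- A biproduct of two one-to-one maps of modules is one-to-one. [folklore] -/
theorem injective_biprod_map {P₁ P₂ Q₁ Q₂ : ModuleCat.{w} R} (f : P₁ ⟶ Q₁) (g : P₂ ⟶ Q₂)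
    (hf : Function.Injective f) (hg : Function.Injective g) :
    Function.Injective (biprod.map f g) := by
  intro y y' h
  refine biprod_apply_ext (hf ?_) (hg ?_)
  · have := congrArg (biprod.fst : Q₁ ⊞ Q₂ ⟶ Q₁) h
    rwa [← ModuleCat.comp_apply, ← ModuleCat.comp_apply, biprod.map_fst, ModuleCat.comp_apply,
      ModuleCat.comp_apply] at this
  · have := congrArg (biprod.snd : Q₁ ⊞ Q₂ ⟶ Q₂) h
    rwa [← ModuleCat.comp_apply, ← ModuleCat.comp_apply, biprod.map_snd, ModuleCat.comp_apply,
      ModuleCat.comp_apply] at this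

end Ladder

/-! ### Transport of ontoness / one-to-one-ness on homology along homeomorphisms -/

section Transport

variable (R : Type v) [CommRing R] (M : Type v) [AddCommGroup M] [Module R M]
variable {A A' B B' : Type u} [TopologicalSpace A] [TopologicalSpace A'] [TopologicalSpace B]
  [TopologicalSpace B']

/-- If `e_B ∘ f = f' ∘ e_A` for homeomorphisms `e_A`, `e_B`, then `f_*` is onto on `Hₙ` iff
`f'_*` is. [folklore] -/
theorem surjective_map_iff_of_homeomorph (eA : A ≃ₜ A') (eB : B ≃ₜ B') (f : C(A, B))
    (f' : C(A', B')) (h : (eB : C(B, B')).comp f = f'.comp (eA : C(A, A'))) (n : ℕ) :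
    Function.Surjective (singularHomology.map R M f n) ↔
      Function.Surjective (singularHomology.map R M f' n) := by
  have hB : Function.Bijective (singularHomology.map R M (eB : C(B, B')) n) :=
    ConcreteCategory.bijective_of_isIso (singularHomology.mapIso R M eB n).hom
  have hA : Function.Bijective (singularHomology.map R M (eA : C(A, A')) n) :=
    ConcreteCategory.bijective_of_isIso (singularHomology.mapIso R M eA n).hom
  have hcomp : (singularHomology.map R M (eB : C(B, B')) n) ∘ (singularHomology.map R M f n) =
      (singularHomology.map R M f' n) ∘ (singularHomology.map R M (eA : C(A, A')) n) := by
    ext x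
    change (singularHomology.map R M f n ≫ singularHomology.map R M (eB : C(B, B')) n) x =
      (singularHomology.map R M (eA : C(A, A')) n ≫ singularHomology.map R M f' n) x
    rw [← singularHomology.map_comp, ← singularHomology.map_comp, h]
  constructor
  · intro hf
    have h1 : Function.Surjective ((singularHomology.map R M f' n) ∘
        (singularHomology.map R M (eA : C(A, A')) n)) := hcomp ▸ hB.2.comp hf
    exact Function.Surjective.of_comp h1
  · intro hf'
    have h1 : Function.Surjective ((singularHomology.map R M (eB : C(B, B')) n) ∘
        (singularHomology.map R M f n)) := hcomp ▸ hf'.comp hA.2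
    exact (Function.Surjective.of_comp_iff' hB _).1 h1

/-- If `e_B ∘ f = f' ∘ e_A` for homeomorphisms `e_A`, `e_B`, then `f_*` is one-to-one on `Hₙ`
iff `f'_*` is. [folklore] -/
theorem injective_map_iff_of_homeomorph (eA : A ≃ₜ A') (eB : B ≃ₜ B') (f : C(A, B))
    (f' : C(A', B')) (h : (eB : C(B, B')).comp f = f'.comp (eA : C(A, A'))) (n : ℕ) :
    Function.Injective (singularHomology.map R M f n) ↔
      Function.Injective (singularHomology.map R M f' n) := by
  have hB : Function.Bijective (singularHomology.map R M (eB : C(B, B')) n) :=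
    ConcreteCategory.bijective_of_isIso (singularHomology.mapIso R M eB n).hom
  have hA : Function.Bijective (singularHomology.map R M (eA : C(A, A')) n) :=
    ConcreteCategory.bijective_of_isIso (singularHomology.mapIso R M eA n).hom
  have hcomp : (singularHomology.map R M (eB : C(B, B')) n) ∘ (singularHomology.map R M f n) =
      (singularHomology.map R M f' n) ∘ (singularHomology.map R M (eA : C(A, A')) n) := by
    ext x
    change (singularHomology.map R M f n ≫ singularHomology.map R M (eB : C(B, B')) n) x =
      (singularHomology.map R M (eA : C(A, A')) n ≫ singularHomology.map R M f' n) x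
    rw [← singularHomology.map_comp, ← singularHomology.map_comp, h]
  constructor
  · intro hf
    have h1 : Function.Injective ((singularHomology.map R M f' n) ∘
        (singularHomology.map R M (eA : C(A, A')) n)) := hcomp ▸ hB.1.comp hf
    exact (Function.Injective.of_comp_iff' _ hA).1 h1
  · intro hf'
    have h1 : Function.Injective ((singularHomology.map R M (eB : C(B, B')) n) ∘
        (singularHomology.map R M f n)) := hcomp ▸ hf'.comp hA.1
    exact Function.Injective.of_comp h1

end Transport

/-! ### The Mayer–Vietoris step: the union of two open sets -/

section Union

variable (R : Type v) [CommRing R] (M : Type v) [AddCommGroup M] [Module R M]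
variable {X : Type u} [TopologicalSpace X] {S : Set X}

/-- The traces of the open sets `U₁ ∖ S`, `U₂ ∖ S` (`S` closed) on `(U₁ ∪ U₂) ∖ S` are open pieces
whose interiors cover it. [folklore] -/
theorem interior_union_interior_diff_eq_univ (hS : IsClosed S) {U₁ U₂ : Set X} (h₁ : IsOpen U₁)
    (h₂ : IsOpen U₂) :
    interior (Subtype.val ⁻¹' (U₁ \ S) : Set ↥((U₁ ∪ U₂) \ S)) ∪
      interior (Subtype.val ⁻¹' (U₂ \ S)) = univ := by
  rw [((h₁.sdiff hS).preimage continuous_subtype_val).interior_eq,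
    ((h₂.sdiff hS).preimage continuous_subtype_val).interior_eq]
  ext x
  simp only [mem_union, mem_preimage, mem_univ, iff_true, mem_sdiff]
  obtain ⟨hx | hx, hxS⟩ := x.2
  · exact Or.inl ⟨hx, hxS⟩
  · exact Or.inr ⟨hx, hxS⟩

/-- Pointwise form of an equality of composites of module maps (different middle objects).
[folklore] -/
private theorem comp_apply_eq_of_eq' {A B B' C : ModuleCat.{w} R} {f : A ⟶ B} {g : B ⟶ C}
    {f' : A ⟶ B'} {g' : B' ⟶ C} (h : f ≫ g = f' ≫ g') (x : A) : g (f x) = g' (f' x) := by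
  rw [← ModuleCat.comp_apply, h, ModuleCat.comp_apply]

/-- **The Mayer–Vietoris step.** Let `S ⊆ X` be closed and `U₁`, `U₂ ⊆ X` open; fix a degree
`q`. Suppose `Hq(Uᵢ ∖ S) → Hq(Uᵢ)` is onto and `Hq₋₁(Uᵢ ∖ S) → Hq₋₁(Uᵢ)` one-to-one for
`i = 1, 2`, and that on the intersection `Hq₋₁((U₁ ∩ U₂) ∖ S) → Hq₋₁(U₁ ∩ U₂)` is onto and
`Hq₋₂((U₁ ∩ U₂) ∖ S) → Hq₋₂(U₁ ∩ U₂)` one-to-one (degrees below `0` being void). Then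
`Hq((U₁ ∪ U₂) ∖ S) → Hq(U₁ ∪ U₂)` is onto and `Hq₋₁((U₁ ∪ U₂) ∖ S) → Hq₋₁(U₁ ∪ U₂)` is
one-to-one: two four-lemma chases (`surjective_of_ladder`, `injective_of_ladder`) on the ladder
formed by the Mayer–Vietoris sequences of the covers `{U₁ ∖ S, U₂ ∖ S}` of `(U₁ ∪ U₂) ∖ S` and
`{U₁, U₂}` of `U₁ ∪ U₂` (Hatcher 2002, §2.2 pp. 149–150, with naturality of the connecting map),
the intersection entering one degree lower. [cite: HatcherAT2002, §2.2 pp. 149–150] -/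
theorem surjective_injective_map_diff_union (hS : IsClosed S) {U₁ U₂ : Set X} (h₁ : IsOpen U₁)
    (h₂ : IsOpen U₂) (q : ℕ)
    (hS₁ : Function.Surjective
      (singularHomology.map R M (subsetInclusion (sdiff_subset : U₁ \ S ⊆ U₁)) q))
    (hS₂ : Function.Surjective
      (singularHomology.map R M (subsetInclusion (sdiff_subset : U₂ \ S ⊆ U₂)) q))
    (hI₁ : ∀ j, j + 1 = q → Function.Injective
      (singularHomology.map R M (subsetInclusion (sdiff_subset : U₁ \ S ⊆ U₁)) j))
    (hI₂ : ∀ j, j + 1 = q → Function.Injective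
      (singularHomology.map R M (subsetInclusion (sdiff_subset : U₂ \ S ⊆ U₂)) j))
    (hS₁₂ : ∀ j, j + 1 = q → Function.Surjective
      (singularHomology.map R M (subsetInclusion (sdiff_subset : (U₁ ∩ U₂) \ S ⊆ U₁ ∩ U₂)) j))
    (hI₁₂ : ∀ j, j + 2 = q → Function.Injective
      (singularHomology.map R M (subsetInclusion (sdiff_subset : (U₁ ∩ U₂) \ S ⊆ U₁ ∩ U₂)) j)) :
    Function.Surjective
        (singularHomology.map R M (subsetInclusion (sdiff_subset : (U₁ ∪ U₂) \ S ⊆ U₁ ∪ U₂)) q) ∧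
      ∀ j, j + 1 = q → Function.Injective
        (singularHomology.map R M (subsetInclusion (sdiff_subset : (U₁ ∪ U₂) \ S ⊆ U₁ ∪ U₂)) j) := by
  -- the two spaces, their covers, excision
  have hcov : interior (Subtype.val ⁻¹' U₁ : Set ↥(U₁ ∪ U₂)) ∪ interior (Subtype.val ⁻¹' U₂) =
      univ := SphereComplement.interior_union_interior_eq_univ h₁ h₂
  have hcov' := interior_union_interior_diff_eq_univ hS h₁ h₂
  have hexc := relativeSingularHomology.isIso_map_of_interior_union_interior_holds R M
    (X := ↥(U₁ ∪ U₂))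
  have hexc' := relativeSingularHomology.isIso_map_of_interior_union_interior_holds R M
    (X := ↥((U₁ ∪ U₂) \ S))
  -- the vertical map of the ladder and its restrictions to the pieces
  set f : C(↥((U₁ ∪ U₂) \ S), ↥(U₁ ∪ U₂)) := subsetInclusion sdiff_subset with hf
  have m₁ : MapsTo f (Subtype.val ⁻¹' (U₁ \ S)) (Subtype.val ⁻¹' U₁) := fun x hx ↦ hx.1
  have m₂ : MapsTo f (Subtype.val ⁻¹' (U₂ \ S)) (Subtype.val ⁻¹' U₂) := fun x hx ↦ hx.1
  -- identification of the restrictions with the inclusions `Uᵢ ∖ S ↪ Uᵢ`, `(U₁ ∩ U₂) ∖ S ↪ U₁ ∩ U₂`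
  have heq : (U₁ \ S) ∩ (U₂ \ S) = (U₁ ∩ U₂) \ S := by
    ext x
    simp only [mem_inter_iff, mem_sdiff]
    tauto
  have c₁ : ((SphereComplement.preimageValHomeomorphOfSubset (subset_union_left : U₁ ⊆ U₁ ∪ U₂)) :
        C(↥(Subtype.val ⁻¹' U₁ : Set ↥(U₁ ∪ U₂)), ↥U₁)).comp (subsetRestrict f m₁) =
      (subsetInclusion (sdiff_subset : U₁ \ S ⊆ U₁)).comp
        ((SphereComplement.preimageValHomeomorphOfSubset
          (sdiff_subset_sdiff_left subset_union_left : U₁ \ S ⊆ (U₁ ∪ U₂) \ S)) :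
          C(↥(Subtype.val ⁻¹' (U₁ \ S) : Set ↥((U₁ ∪ U₂) \ S)), ↥(U₁ \ S))) :=
    ContinuousMap.ext fun _ ↦ Subtype.ext rfl
  have c₂ : ((SphereComplement.preimageValHomeomorphOfSubset (subset_union_right : U₂ ⊆ U₁ ∪ U₂)) :
        C(↥(Subtype.val ⁻¹' U₂ : Set ↥(U₁ ∪ U₂)), ↥U₂)).comp (subsetRestrict f m₂) =
      (subsetInclusion (sdiff_subset : U₂ \ S ⊆ U₂)).comp
        ((SphereComplement.preimageValHomeomorphOfSubset
          (sdiff_subset_sdiff_left subset_union_right : U₂ \ S ⊆ (U₁ ∪ U₂) \ S)) :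
          C(↥(Subtype.val ⁻¹' (U₂ \ S) : Set ↥((U₁ ∪ U₂) \ S)), ↥(U₂ \ S))) :=
    ContinuousMap.ext fun _ ↦ Subtype.ext rfl
  have c₁₂ : (((Homeomorph.setCongr (rfl : (Subtype.val ⁻¹' U₁ : Set ↥(U₁ ∪ U₂)) ∩
            Subtype.val ⁻¹' U₂ = Subtype.val ⁻¹' (U₁ ∩ U₂))).trans
          (SphereComplement.preimageValHomeomorphOfSubset
            (inter_subset_left.trans subset_union_left : U₁ ∩ U₂ ⊆ U₁ ∪ U₂))) :
        C(↥((Subtype.val ⁻¹' U₁ : Set ↥(U₁ ∪ U₂)) ∩ Subtype.val ⁻¹' U₂), ↥(U₁ ∩ U₂))).comp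
        (subsetRestrict f (m₁.inter_inter m₂)) =
      (subsetInclusion (sdiff_subset : (U₁ ∩ U₂) \ S ⊆ U₁ ∩ U₂)).comp
        ((((Homeomorph.setCongr (rfl :
            (Subtype.val ⁻¹' (U₁ \ S) : Set ↥((U₁ ∪ U₂) \ S)) ∩ Subtype.val ⁻¹' (U₂ \ S) =
              Subtype.val ⁻¹' ((U₁ \ S) ∩ (U₂ \ S)))).trans
          ((SphereComplement.preimageValHomeomorphOfSubset
            ((inter_subset_left.trans (sdiff_subset_sdiff_left subset_union_left)) :
              (U₁ \ S) ∩ (U₂ \ S) ⊆ (U₁ ∪ U₂) \ S)).trans (Homeomorph.setCongr heq))) :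
          C(↥((Subtype.val ⁻¹' (U₁ \ S) : Set ↥((U₁ ∪ U₂) \ S)) ∩ Subtype.val ⁻¹' (U₂ \ S)),
            ↥((U₁ ∩ U₂) \ S)))) :=
    ContinuousMap.ext fun _ ↦ Subtype.ext rfl
  -- the vertical maps, degreewise
  have ha : ∀ n, (Function.Surjective
        (singularHomology.map R M (subsetInclusion (sdiff_subset : U₁ \ S ⊆ U₁)) n) →
      Function.Surjective
        (singularHomology.map R M (subsetInclusion (sdiff_subset : U₂ \ S ⊆ U₂)) n) →
      Function.Surjective (biprod.map (singularHomology.map R M (subsetRestrict f m₁) n)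
        (singularHomology.map R M (subsetRestrict f m₂) n))) := fun n u v ↦
    surjective_biprod_map _ _ ((surjective_map_iff_of_homeomorph R M _ _ _ _ c₁ n).2 u)
      ((surjective_map_iff_of_homeomorph R M _ _ _ _ c₂ n).2 v)
  have ha' : ∀ n, (Function.Injective
        (singularHomology.map R M (subsetInclusion (sdiff_subset : U₁ \ S ⊆ U₁)) n) →
      Function.Injective
        (singularHomology.map R M (subsetInclusion (sdiff_subset : U₂ \ S ⊆ U₂)) n) →
      Function.Injective (biprod.map (singularHomology.map R M (subsetRestrict f m₁) n)
        (singularHomology.map R M (subsetRestrict f m₂) n))) := fun n u v ↦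
    injective_biprod_map _ _ ((injective_map_iff_of_homeomorph R M _ _ _ _ c₁ n).2 u)
      ((injective_map_iff_of_homeomorph R M _ _ _ _ c₂ n).2 v)
  have hc : ∀ n, Function.Surjective
        (singularHomology.map R M (subsetInclusion (sdiff_subset : (U₁ ∩ U₂) \ S ⊆ U₁ ∩ U₂)) n) →
      Function.Surjective (singularHomology.map R M (subsetRestrict f (m₁.inter_inter m₂)) n) :=
    fun n u ↦ (surjective_map_iff_of_homeomorph R M _ _ _ _ c₁₂ n).2 u
  have hc' : ∀ n, Function.Injective
        (singularHomology.map R M (subsetInclusion (sdiff_subset : (U₁ ∩ U₂) \ S ⊆ U₁ ∩ U₂)) n) →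
      Function.Injective (singularHomology.map R M (subsetRestrict f (m₁.inter_inter m₂)) n) :=
    fun n u ↦ (injective_map_iff_of_homeomorph R M _ _ _ _ c₁₂ n).2 u
  -- the three squares of the ladder
  have sqψ : ∀ n, mayerVietoris.ψ R M (Subtype.val ⁻¹' (U₁ \ S) : Set ↥((U₁ ∪ U₂) \ S))
        (Subtype.val ⁻¹' (U₂ \ S)) n ≫ singularHomology.map R M f n =
      biprod.map (singularHomology.map R M (subsetRestrict f m₁) n)
        (singularHomology.map R M (subsetRestrict f m₂) n) ≫
        mayerVietoris.ψ R M (Subtype.val ⁻¹' U₁ : Set ↥(U₁ ∪ U₂)) (Subtype.val ⁻¹' U₂) n := by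
    intro n
    refine biprod.hom_ext' _ _ ?_ ?_
    · rw [mayerVietoris.ψ, mayerVietoris.ψ, biprod.inl_desc_assoc, biprod.inl_map_assoc,
        biprod.inl_desc, ← singularHomology.map_comp, ← singularHomology.map_comp]
      rfl
    · rw [mayerVietoris.ψ, mayerVietoris.ψ, biprod.inr_desc_assoc, biprod.inr_map_assoc,
        biprod.inr_desc, ← singularHomology.map_comp, ← singularHomology.map_comp]
      rfl
  have sqφ : ∀ n, mayerVietoris.φ R M (Subtype.val ⁻¹' (U₁ \ S) : Set ↥((U₁ ∪ U₂) \ S))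
        (Subtype.val ⁻¹' (U₂ \ S)) n ≫
        biprod.map (singularHomology.map R M (subsetRestrict f m₁) n)
          (singularHomology.map R M (subsetRestrict f m₂) n) =
      singularHomology.map R M (subsetRestrict f (m₁.inter_inter m₂)) n ≫
        mayerVietoris.φ R M (Subtype.val ⁻¹' U₁ : Set ↥(U₁ ∪ U₂)) (Subtype.val ⁻¹' U₂) n := by
    intro n
    refine biprod.hom_ext _ _ ?_ ?_
    · rw [mayerVietoris.φ, mayerVietoris.φ, Category.assoc, biprod.map_fst, biprod.lift_fst_assoc,
        Category.assoc, biprod.lift_fst, ← singularHomology.map_comp, ← singularHomology.map_comp]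
      rfl
    · rw [mayerVietoris.φ, mayerVietoris.φ, Category.assoc, biprod.map_snd, biprod.lift_snd_assoc,
        Category.assoc, biprod.lift_snd, Preadditive.neg_comp, Preadditive.comp_neg,
        ← singularHomology.map_comp, ← singularHomology.map_comp]
      rfl
  have sqδ : ∀ n, mayerVietoris.δ R M (Subtype.val ⁻¹' (U₁ \ S) : Set ↥((U₁ ∪ U₂) \ S))
        (Subtype.val ⁻¹' (U₂ \ S)) hexc' hcov' n ≫
        singularHomology.map R M (subsetRestrict f (m₁.inter_inter m₂)) n =
      singularHomology.map R M f (n + 1) ≫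
        mayerVietoris.δ R M (Subtype.val ⁻¹' U₁ : Set ↥(U₁ ∪ U₂)) (Subtype.val ⁻¹' U₂)
          hexc hcov n := fun n ↦
    mayerVietoris.δ_naturality_holds R M hexc' hexc f m₁ m₂ hcov' hcov n
  -- exactness, elementwise
  have ex₁ : ∀ n p, mayerVietoris.ψ R M (Subtype.val ⁻¹' U₁ : Set ↥(U₁ ∪ U₂))
        (Subtype.val ⁻¹' U₂) n p = 0 →
      ∃ y, mayerVietoris.φ R M (Subtype.val ⁻¹' U₁ : Set ↥(U₁ ∪ U₂)) (Subtype.val ⁻¹' U₂) n y = p :=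
    fun n ↦ (ShortComplex.moduleCat_exact_iff _).mp (mayerVietoris.exact₁_holds R M _ _ hcov n)
  have ex₂ : ∀ n t, mayerVietoris.δ R M (Subtype.val ⁻¹' U₁ : Set ↥(U₁ ∪ U₂))
        (Subtype.val ⁻¹' U₂) hexc hcov n t = 0 →
      ∃ p, mayerVietoris.ψ R M (Subtype.val ⁻¹' U₁ : Set ↥(U₁ ∪ U₂)) (Subtype.val ⁻¹' U₂)
        (n + 1) p = t :=
    fun n ↦ (ShortComplex.moduleCat_exact_iff _).mp (mayerVietoris.exact₂_holds R M _ _ hexc hcov n)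
  have ex₂' : ∀ n t, mayerVietoris.δ R M (Subtype.val ⁻¹' (U₁ \ S) : Set ↥((U₁ ∪ U₂) \ S))
        (Subtype.val ⁻¹' (U₂ \ S)) hexc' hcov' n t = 0 →
      ∃ p, mayerVietoris.ψ R M (Subtype.val ⁻¹' (U₁ \ S) : Set ↥((U₁ ∪ U₂) \ S))
        (Subtype.val ⁻¹' (U₂ \ S)) (n + 1) p = t :=
    fun n ↦ (ShortComplex.moduleCat_exact_iff _).mp
      (mayerVietoris.exact₂_holds R M _ _ hexc' hcov' n)
  have ex₃' : ∀ n y, mayerVietoris.φ R M (Subtype.val ⁻¹' (U₁ \ S) : Set ↥((U₁ ∪ U₂) \ S))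
        (Subtype.val ⁻¹' (U₂ \ S)) n y = 0 →
      ∃ t, mayerVietoris.δ R M (Subtype.val ⁻¹' (U₁ \ S) : Set ↥((U₁ ∪ U₂) \ S))
        (Subtype.val ⁻¹' (U₂ \ S)) hexc' hcov' n t = y :=
    fun n ↦ (ShortComplex.moduleCat_exact_iff _).mp
      (mayerVietoris.exact₃_holds R M _ _ hexc' hcov' n)
  have hψ0 := mayerVietoris.ψ_surjective_zero R M (Subtype.val ⁻¹' U₁ : Set ↥(U₁ ∪ U₂))
    (Subtype.val ⁻¹' U₂) hexc hcov
  have hψ0' := mayerVietoris.ψ_surjective_zero R M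
    (Subtype.val ⁻¹' (U₁ \ S) : Set ↥((U₁ ∪ U₂) \ S)) (Subtype.val ⁻¹' (U₂ \ S)) hexc' hcov'
  refine ⟨?_, ?_⟩
  · -- ontoness in degree `q`
    cases q with
    | zero =>
      exact surjective_of_ladder_zero _ _ _ _ (comp_apply_eq_of_eq' R (sqψ 0)) hψ0
        (ha 0 hS₁ hS₂)
    | succ n =>
      refine surjective_of_ladder _ _ _ _ _ _ _ _ _ _ (comp_apply_eq_of_eq' R (sqψ (n + 1)))
        (comp_apply_eq_of_eq' R (sqδ n)) (comp_apply_eq_of_eq' R (sqφ n))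
        (fun x ↦ ?_) (ex₂ n) (ex₃' n) (ha (n + 1) hS₁ hS₂) (hc n (hS₁₂ n rfl))
        (ha' n (hI₁ n rfl) (hI₂ n rfl))
      rw [← ModuleCat.comp_apply, mayerVietoris.δ_comp_φ]
      rfl
  · -- one-to-one-ness in degree `j`, `j + 1 = q`
    intro j hj
    subst hj
    cases j with
    | zero =>
      refine injective_of_ladder_zero _ _ _ _ _ _ _ (comp_apply_eq_of_eq' R (sqφ 0))
        (comp_apply_eq_of_eq' R (sqψ 0)) (fun x ↦ ?_) hψ0' (ex₁ 0) (hc 0 (hS₁₂ 0 rfl))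
        (ha' 0 (hI₁ 0 rfl) (hI₂ 0 rfl))
      rw [← ModuleCat.comp_apply, mayerVietoris.φ_comp_ψ]
      rfl
    | succ n =>
      refine injective_of_ladder _ _ _ _ _ _ _ _ _ _ (comp_apply_eq_of_eq' R (sqφ (n + 1)))
        (comp_apply_eq_of_eq' R (sqψ (n + 1))) (comp_apply_eq_of_eq' R (sqδ n)) (fun x ↦ ?_)
        (ex₂' n) (ex₁ (n + 1)) (hc (n + 1) (hS₁₂ (n + 1) rfl))
        (ha' (n + 1) (hI₁ (n + 1) rfl) (hI₂ (n + 1) rfl)) (hc' n (hI₁₂ n rfl))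
      rw [← ModuleCat.comp_apply, mayerVietoris.φ_comp_ψ]
      rfl

end Union

/-! ### Increasing unions: compact supports -/

section Unions

variable (R : Type v) [CommRing R] (M : Type v) [AddCommGroup M] [Module R M]
variable {X : Type u} [TopologicalSpace X] {S : Set X}

omit [TopologicalSpace X] in
/-- A tail of an increasing sequence of sets has the same union. [folklore] -/
theorem iUnion_add_eq_of_monotone {W : ℕ → Set X} (hWm : Monotone W) (m : ℕ) :
    ⋃ n, W (m + n) = ⋃ n, W n :=
  Subset.antisymm (iUnion_subset fun n ↦ subset_iUnion W (m + n))
    (iUnion_subset fun n ↦ (hWm (Nat.le_add_left n m)).trans (subset_iUnion (fun n ↦ W (m + n)) n))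

/-- **Passage to an increasing union** (Hatcher 2002, Prop. 3.33: singular homology has compact
supports). Let `S` be closed and `W₀ ⊆ W₁ ⊆ ⋯` open with union `V`. If in degree `q` every
`Hq(Wₘ ∖ S) → Hq(Wₘ)` is onto and every `Hq₋₁(Wₘ ∖ S) → Hq₋₁(Wₘ)` is one-to-one, then
`Hq(V ∖ S) → Hq(V)` is onto and `Hq₋₁(V ∖ S) → Hq₋₁(V)` is one-to-one: a class of `Hq(V)` comes
from some `Wₘ` (`singularHomology.exists_eq_map_of_iUnion`); a class of `Hq₋₁(V ∖ S)` dying in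
`V` comes from some `Wₘ ∖ S`, its image in `Wₘ` dies in some `W_{m+n}`
(`exists_map_eq_zero_of_iUnion`), hence it dies in `W_{m+n} ∖ S`. [cite: HatcherAT2002, §3.3 Prop. 3.33] -/
theorem surjective_injective_map_diff_iUnion (hS : IsClosed S) (W : ℕ → Set X)
    (hWo : ∀ m, IsOpen (W m)) (hWm : Monotone W) (q : ℕ)
    (hSW : ∀ m, Function.Surjective
      (singularHomology.map R M (subsetInclusion (sdiff_subset : W m \ S ⊆ W m)) q))
    (hIW : ∀ m j, j + 1 = q → Function.Injective
      (singularHomology.map R M (subsetInclusion (sdiff_subset : W m \ S ⊆ W m)) j)) :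
    Function.Surjective (singularHomology.map R M
        (subsetInclusion (sdiff_subset : (⋃ m, W m) \ S ⊆ ⋃ m, W m)) q) ∧
      ∀ j, j + 1 = q → Function.Injective (singularHomology.map R M
        (subsetInclusion (sdiff_subset : (⋃ m, W m) \ S ⊆ ⋃ m, W m)) j) := by
  -- the sequence `Wₘ ∖ S`
  have hWo' : ∀ m, IsOpen (W m \ S) := fun m ↦ (hWo m).sdiff hS
  have hWm' : Monotone fun m ↦ W m \ S := fun a b h ↦ sdiff_subset_sdiff_left (hWm h)
  have hV' : ⋃ m, (W m \ S) = (⋃ m, W m) \ S := (iUnion_sdiff S W).symm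
  -- compatibilities of inclusions
  have hcomp₁ : ∀ m, (subsetInclusion (subset_iUnion W m)).comp
      (subsetInclusion (sdiff_subset : W m \ S ⊆ W m)) =
      (subsetInclusion (sdiff_subset : (⋃ m, W m) \ S ⊆ ⋃ m, W m)).comp
        (subsetInclusion (hV' ▸ subset_iUnion (fun m ↦ W m \ S) m : W m \ S ⊆ (⋃ m, W m) \ S)) :=
    fun m ↦ rfl
  refine ⟨?_, ?_⟩
  · intro x
    obtain ⟨m, x', rfl⟩ := singularHomology.exists_eq_map_of_iUnion W hWo hWm rfl q x
    obtain ⟨y, rfl⟩ := hSW m x'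
    refine ⟨singularHomology.map R M (subsetInclusion
      (hV' ▸ subset_iUnion (fun m ↦ W m \ S) m : W m \ S ⊆ (⋃ m, W m) \ S)) q y, ?_⟩
    rw [← ModuleCat.comp_apply, ← singularHomology.map_comp, ← hcomp₁ m,
      singularHomology.map_comp, ModuleCat.comp_apply]
  · intro j hj
    refine (injective_iff_map_eq_zero _).2 fun z hz ↦ ?_
    obtain ⟨m, z', rfl⟩ :=
      singularHomology.exists_eq_map_of_iUnion (fun m ↦ W m \ S) hWo' hWm' hV' j z
    -- the image of `z'` in `Wₘ` dies in the union, hence in some `W_{m+n}`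
    have h1 : singularHomology.map R M (subsetInclusion (subset_iUnion W m)) j
        (singularHomology.map R M (subsetInclusion (sdiff_subset : W m \ S ⊆ W m)) j z') = 0 := by
      rw [← ModuleCat.comp_apply, ← singularHomology.map_comp, hcomp₁ m,
        singularHomology.map_comp, ModuleCat.comp_apply, hz]
    have hWmn : Monotone fun n ↦ W (m + n) := fun a b h ↦ hWm (Nat.add_le_add_left h m)
    obtain ⟨n, hn⟩ := singularHomology.exists_map_eq_zero_of_iUnion (fun n ↦ W (m + n))
      (fun n ↦ hWo (m + n)) hWmn (iUnion_add_eq_of_monotone hWm m) j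
      (singularHomology.map R M (subsetInclusion (sdiff_subset : W m \ S ⊆ W m)) j z') h1
    -- so `z'` dies in `W_{m+n} ∖ S`
    have hcomp₂ : (subsetInclusion (hWmn (Nat.zero_le n) : W (m + 0) ⊆ W (m + n))).comp
        (subsetInclusion (sdiff_subset : W m \ S ⊆ W m)) =
        (subsetInclusion (sdiff_subset : W (m + n) \ S ⊆ W (m + n))).comp
          (subsetInclusion (hWm' (Nat.le_add_right m n) : W m \ S ⊆ W (m + n) \ S)) := rfl
    rw [← ModuleCat.comp_apply, ← singularHomology.map_comp, hcomp₂, singularHomology.map_comp,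
      ModuleCat.comp_apply] at hn
    have h2 := (injective_iff_map_eq_zero _).1 (hIW (m + n) j hj) _ hn
    have hcomp₃ : (subsetInclusion
        (hV' ▸ subset_iUnion (fun m ↦ W m \ S) m : W m \ S ⊆ (⋃ m, W m) \ S)) =
        (subsetInclusion (hV' ▸ subset_iUnion (fun m ↦ W m \ S) (m + n) :
          W (m + n) \ S ⊆ (⋃ m, W m) \ S)).comp
          (subsetInclusion (hWm' (Nat.le_add_right m n) : W m \ S ⊆ W (m + n) \ S)) := rfl
    rw [hcomp₃, singularHomology.map_comp, ModuleCat.comp_apply, h2, map_zero]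

end Unions

/-! ### The theorem: from a basis of good open sets to all open sets -/

section Basis

variable (R : Type v) [CommRing R] (M : Type v) [AddCommGroup M] [Module R M]
variable {X : Type u} [TopologicalSpace X] {S : Set X}

/-- **Local-to-global for the homology of the complement of a closed subset** (the engine of
"semipurity"; method of Hatcher 2002, §3.3, proof of Thm. 3.35 / Lemma 3.36, with compact
supports, Prop. 3.33). Let `X` be second countable, `S ⊆ X` closed, `k : ℕ`, and `𝓖` a basis
of the topology such that for every `B ∈ 𝓖` and every `q < k` the map `Hq(B ∖ S) → Hq(B)` is
onto and `Hq₋₁(B ∖ S) → Hq₋₁(B)` is one-to-one. Then for EVERY open `U ⊆ X` and every `q < k`,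
`Hq(U ∖ S) → Hq(U)` is onto and `Hq₋₁(U ∖ S) → Hq₋₁(U)` is one-to-one (i.e. `Hq(U, U ∖ S) = 0`
for `q < k`). Proof by strong induction on `q`: finite unions `B₀ ∪ ⋯ ∪ Bₘ` of basic sets by
the Mayer–Vietoris step (`surjective_injective_map_diff_union`), the intersection
`(B₀ ∪ ⋯ ∪ Bₘ₋₁) ∩ Bₘ` — an arbitrary open set — entering in degrees `< q` only; a general
open set is the increasing union of such (`isOpen_sUnion_countable`), handled by
`surjective_injective_map_diff_iUnion`. With `S` a closed submanifold of codimension `k` and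
`𝓖` its straightening charts this is C. Voisin's Lemma 11.13 (Hodge Theory I, §11.1.2) without
tubular neighbourhoods. [cite: HatcherAT2002, §3.3 proof of Thm. 3.35 and Prop. 3.33]
[cite: VoisinHodgeI2002, §11.1.2 Lemma 11.13] -/
theorem surjective_injective_map_diff_of_isTopologicalBasis [SecondCountableTopology X]
    (hS : IsClosed S) {𝓖 : Set (Set X)} (h𝓖 : IsTopologicalBasis 𝓖) (k : ℕ)
    (hgood : ∀ B ∈ 𝓖, ∀ q < k, Function.Surjective
        (singularHomology.map R M (subsetInclusion (sdiff_subset : B \ S ⊆ B)) q) ∧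
      ∀ j, j + 1 = q → Function.Injective
        (singularHomology.map R M (subsetInclusion (sdiff_subset : B \ S ⊆ B)) j))
    {U : Set X} (hU : IsOpen U) {q : ℕ} (hq : q < k) :
    Function.Surjective
        (singularHomology.map R M (subsetInclusion (sdiff_subset : U \ S ⊆ U)) q) ∧
      ∀ j, j + 1 = q → Function.Injective
        (singularHomology.map R M (subsetInclusion (sdiff_subset : U \ S ⊆ U)) j) := by
  induction q using Nat.strong_induction_on generalizing U with
  | _ q IH =>
  -- (A) finite unions of basic open sets
  have hA : ∀ (g : ℕ → Set X), (∀ i, g i ∈ 𝓖) → ∀ m,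
      Function.Surjective (singularHomology.map R M
        (subsetInclusion (sdiff_subset : accumulate g m \ S ⊆ accumulate g m)) q) ∧
      ∀ j, j + 1 = q → Function.Injective (singularHomology.map R M
        (subsetInclusion (sdiff_subset : accumulate g m \ S ⊆ accumulate g m)) j) := by
    intro g hg m
    induction m with
    | zero =>
      rw [accumulate_zero_nat]
      exact hgood (g 0) (hg 0) q hq
    | succ m ihm =>
      rw [accumulate_succ]
      have ho : IsOpen (accumulate g m) := by
        rw [accumulate_def]
        exact isOpen_biUnion fun i _ ↦ h𝓖.isOpen (hg i)
      have ho' : IsOpen (g (m + 1)) := h𝓖.isOpen (hg (m + 1))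
      have hB := hgood (g (m + 1)) (hg (m + 1)) q hq
      refine surjective_injective_map_diff_union R M hS ho ho' q ihm.1 hB.1 ihm.2 hB.2
        (fun j hj ↦ (IH j (by omega) (ho.inter ho') (by omega)).1) (fun j hj ↦ ?_)
      exact (IH (j + 1) (by omega) (ho.inter ho') (by omega)).2 j rfl
  -- (B) a general open set is an increasing union of finite unions of basic open sets
  obtain ⟨T₀, hT₀, hUT₀⟩ := h𝓖.open_eq_sUnion hU
  obtain ⟨T, hTc, hTT₀, hTU⟩ := isOpen_sUnion_countable T₀ fun s hs ↦ h𝓖.isOpen (hT₀ hs)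
  rw [← hUT₀] at hTU
  rcases T.eq_empty_or_nonempty with hT | hT
  · -- `U = ∅`: all groups vanish (no singular simplices; this is
    -- `Literature.Topology.FourManifolds.isZero_singularHomology_of_isEmpty`, re-derived in two
    -- lines rather than imported from the four-manifold files)
    rw [hT, sUnion_empty] at hTU
    subst hTU
    have hzero : ∀ (E : Type u) [TopologicalSpace E] [IsEmpty E] (n : ℕ),
        IsZero (singularHomology R M E n) := by
      intro E _ _ n
      have hE : IsZero ((singularChainComplex R M E).X n) := by
        rw [IsZero.iff_id_eq_zero]
        exact singularChainComplex.hom_ext fun σ _ ↦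
          isEmptyElim (SingularSimplex.toContinuousMap σ (Classical.arbitrary _))
      exact ShortComplex.isZero_homology_of_isZero_X₂ _ hE
    haveI : IsEmpty ↥(∅ : Set X) := by simp
    haveI : IsEmpty ↥((∅ : Set X) \ S) := ⟨fun x ↦ x.2.1⟩
    refine ⟨fun x ↦ ⟨0, ?_⟩, fun j _ ↦ fun x y _ ↦ ?_⟩
    · haveI := ModuleCat.subsingleton_of_isZero (hzero ↥(∅ : Set X) q)
      exact Subsingleton.elim _ _
    · haveI := ModuleCat.subsingleton_of_isZero (hzero ↥((∅ : Set X) \ S) j)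
      exact Subsingleton.elim _ _
  · obtain ⟨g, hg⟩ := hTc.exists_eq_range hT
    have hgT : ∀ i, g i ∈ 𝓖 := fun i ↦ hT₀ (hTT₀ (hg ▸ mem_range_self i))
    have hWU : ⋃ m, accumulate g m = U := by
      rw [iUnion_accumulate, ← hTU, hg, sUnion_range]
    subst hWU
    have ho : ∀ m, IsOpen (accumulate g m) := fun m ↦ by
      rw [accumulate_def]
      exact isOpen_biUnion fun i _ ↦ h𝓖.isOpen (hgT i)
    exact surjective_injective_map_diff_iUnion R M hS (accumulate g) ho monotone_accumulate q
      (fun m ↦ (hA g hgT m).1) (fun m ↦ (hA g hgT m).2)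

/-- **`Hq(X ∖ S) → Hq(X)` is onto for `q < k`** under the hypotheses of
`surjective_injective_map_diff_of_isTopologicalBasis` (the case `U = X`).
[cite: HatcherAT2002, §3.3 proof of Thm. 3.35 and Prop. 3.33] [cite: VoisinHodgeI2002, §11.1.2 Lemma 11.13] -/
theorem surjective_map_compl_of_isTopologicalBasis [SecondCountableTopology X] (hS : IsClosed S)
    {𝓖 : Set (Set X)} (h𝓖 : IsTopologicalBasis 𝓖) (k : ℕ)
    (hgood : ∀ B ∈ 𝓖, ∀ q < k, Function.Surjective
        (singularHomology.map R M (subsetInclusion (sdiff_subset : B \ S ⊆ B)) q) ∧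
      ∀ j, j + 1 = q → Function.Injective
        (singularHomology.map R M (subsetInclusion (sdiff_subset : B \ S ⊆ B)) j))
    {q : ℕ} (hq : q < k) :
    Function.Surjective (singularHomology.map R M (subsetIncl Sᶜ) q) := by
  have h := (surjective_injective_map_diff_of_isTopologicalBasis R M hS h𝓖 k hgood isOpen_univ
    hq).1
  have hc : ((Homeomorph.Set.univ X : ↥(univ : Set X) ≃ₜ X) : C(↥(univ : Set X), X)).comp
      (subsetInclusion (sdiff_subset : univ \ S ⊆ univ)) =
      (subsetIncl Sᶜ).comp ((Homeomorph.setCongr (compl_eq_univ_sdiff S).symm :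
        ↥(univ \ S) ≃ₜ ↥Sᶜ) : C(↥(univ \ S), ↥Sᶜ)) :=
    ContinuousMap.ext fun _ ↦ rfl
  exact (surjective_map_iff_of_homeomorph R M _ _ _ _ hc q).1 h

/-- **`Hq(X ∖ S) → Hq(X)` is one-to-one for `q + 1 < k`** under the hypotheses of
`surjective_injective_map_diff_of_isTopologicalBasis` (the case `U = X`).
[cite: HatcherAT2002, §3.3 proof of Thm. 3.35 and Prop. 3.33] [cite: VoisinHodgeI2002, §11.1.2 Lemma 11.13] -/
theorem injective_map_compl_of_isTopologicalBasis [SecondCountableTopology X] (hS : IsClosed S)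
    {𝓖 : Set (Set X)} (h𝓖 : IsTopologicalBasis 𝓖) (k : ℕ)
    (hgood : ∀ B ∈ 𝓖, ∀ q < k, Function.Surjective
        (singularHomology.map R M (subsetInclusion (sdiff_subset : B \ S ⊆ B)) q) ∧
      ∀ j, j + 1 = q → Function.Injective
        (singularHomology.map R M (subsetInclusion (sdiff_subset : B \ S ⊆ B)) j))
    {q : ℕ} (hq : q + 1 < k) :
    Function.Injective (singularHomology.map R M (subsetIncl Sᶜ) q) := by
  have h := (surjective_injective_map_diff_of_isTopologicalBasis R M hS h𝓖 k hgood isOpen_univ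
    hq).2 q rfl
  have hc : ((Homeomorph.Set.univ X : ↥(univ : Set X) ≃ₜ X) : C(↥(univ : Set X), X)).comp
      (subsetInclusion (sdiff_subset : univ \ S ⊆ univ)) =
      (subsetIncl Sᶜ).comp ((Homeomorph.setCongr (compl_eq_univ_sdiff S).symm :
        ↥(univ \ S) ≃ₜ ↥Sᶜ) : C(↥(univ \ S), ↥Sᶜ)) :=
    ContinuousMap.ext fun _ ↦ rfl
  exact (injective_map_iff_of_homeomorph R M _ _ _ _ hc q).1 h

end Basis

end Literature.AlgebraicTopology.SingularHomology

end
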